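import Summits.CriticalPhenomena.PercolationContinuityZ3.Theorems.Transplant.PlanarCellsNarrowDefs
import Summits.CriticalPhenomena.PercolationContinuityZ3.Theorems.Transplant.PlanarSkeletonPrisms
import HarnessLib

/-!
# Kozma–Nitzan's planar cells in `ℤ²`, NARROW VARIANT, part 2: every no-edge separation of the scheme in ℓ^∞-GAP-2 form
# (`PlanarSkeleton.SepInf`, consumed by the generic lift `PlanarSkeleton.sep_of_sepInf` under `lip` alone — ruling (A2) of
# `HOME/SHEAR-SCOPE.md` §p3 3.0 item 3 / §3.9 Layer 1), and the narrow probe world with `hSQ / hSB / hSS`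

builds on p205010 (kernel theorem, internal audit signed; external expert review pending) — nothing in this file uses p205010.
Lane `prim-bschramm`, typed by the `prim-hp-8` lineage (gen 22) on the lead's assignment 2026-08-20T17:50:22Z; helper file
(`--supports stmt-CriticalPhenomena-4575 --as helper`).  NEW FILE; continues `PlanarCellsNarrowDefs`; the frozen `PlanarCells*` are imported.

`SepInf A B` (p3-g4's `PlanarSkeletonPrisms` §3) says: every `y ∈ A`, `z ∈ B` differ by `≥ 2` in SOME coordinate.  It implies KN's
`ℤ²`-separation `KozmaNitzan.Sep` (`sepZ2_of_sepInf`) and, unlike it, lifts to any planar skeleton with diagonal edges (fcc).  The WIDE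
boxes already satisfy it wherever the gap is `≥ min (5r, 10s)`: `Cell / Q` (`5r`), `Zone / Q` (`≥ 10s`), `Cell / E^far` (`5r`),
`Zone / E^far` (`10s`), sibling `Btw / Q_{v+δ}` (`10r`); the one tight pair is the sibling between-box against `E^far_{v,δ}` across the axis,
which holds in gap-2 form for the NARROW between-box `BtwN v δ'` against the WIDE `E^far_{v,δ}` (`(5r+1) − (5r−1) = 2`) — hence for
`EfarN` by monotonicity.
* generalities: `sepInf_of_gap`, `sepZ2_of_sepInf`, `sepInf_union_left/right`, `lev_le_lev_add_one_of_abs_sub_le_one` (levels move by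
  `≤ 1` along any edge that moves the planar coordinates by `≤ 1` — the `lip` form of `lev_adj`);
* wide, gap-2: `Cell_sepInf_Q`, `Zone_sepInf_Q`, `Cell_sepInf_Efar`, `Zone_sepInf_Efar`, `Btw_sepInf_Q_add`; narrow: **`BtwN_sepInf_Efar`**;
  the `EfarN` forms `Cell_sepInf_EfarN`, `Zone_sepInf_EfarN`, `BtwN_sepInf_EfarN`, `BtwN_sepInf_Q_add` and their `ℤ²` corollaries
  `Cell_sep_EfarN`, `Zone_sep_EfarN`, `BtwN_sep_EfarN`;
* `probeWorldN v δ du = BtwN v δ ∪ Q x ∪ Hfull x du` (`x = v + δ`), `probeWorldN_subset`, `Cell_sepInf_probeWorldN`, `Zone_sepInf_probeWorldN`,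
  **`Q_sepInf_probeWorldN`** (hSQ), **`BtwN_sepInf_probeWorldN`** (hSB), **`Stub_sepInf_probeWorldN`** (hSS), and the `ℤ²` forms
  `Q_sep_probeWorldN`, `BtwN_sep_probeWorldN`, `Stub_sep_probeWorldN` (same hypothesis lists as `PlanarCellsPSep3`).
[cite: KozmaNitzan2024, §4 p. 26 ((29)), p. 31 ((31)) — the ℤ^d model]
-/

noncomputable section

namespace Summit.CriticalPhenomena.PercolationContinuityZ3.Theorems

namespace Transplant

open Literature.Probability.Percolation Literature.Probability.LatticeModels SimpleGraph GadgetSystem Contour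
open Literature.Probability.Percolation.KozmaNitzan
open Literature.Probability.Percolation.KozmaNitzan.Cells (oth oth_ne sgOf sgOf_sign stepVec_apply_fst stepVec_apply_oth eq_oth_of_ne oth_oth
  eq_of_coords)
open PlanarSkeleton (SepInf)

namespace PCells

variable (C : PCells)

/-! ## ℓ^∞-gap separation: generalities -/

/-- A gap of `2` in one coordinate is an ℓ^∞-gap of `2`. [folklore] -/
theorem sepInf_of_gap {y z : Site 2} (i : Fin 2) (h : y i + 2 ≤ z i ∨ z i + 2 ≤ y i) : ∃ j : Fin 2, (2 : ℤ) ≤ |y j - z j| :=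
  ⟨i, by rw [le_abs]; omega⟩

/-- ℓ^∞-gap separation implies Kozma–Nitzan's `ℤ²`-separation (no common vertex, no `ℤ²`-edge). [folklore] -/
theorem sepZ2_of_sepInf {A B : Set (Site 2)} (h : SepInf A B) : KozmaNitzan.Sep A B := by
  intro y hy z hz
  obtain ⟨i, hi⟩ := h y hy z hz
  rw [le_abs] at hi
  exact sep_of_gap i (by omega)

/-- ℓ^∞-gap separation from a union on the left. [folklore] -/
theorem sepInf_union_left {A A' B : Set (Site 2)} (h : SepInf A B) (h' : SepInf A' B) : SepInf (A ∪ A') B := by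
  rintro y (hy | hy) z hz
  · exact h y hy z hz
  · exact h' y hy z hz

/-- ℓ^∞-gap separation from a union on the right. [folklore] -/
theorem sepInf_union_right {A B B' : Set (Site 2)} (h : SepInf A B) (h' : SepInf A B') : SepInf A (B ∪ B') := by
  rintro y hy z (hz | hz)
  · exact h y hy z hz
  · exact h' y hy z hz

/-- **Levels move by at most one along any step that moves the planar coordinates by at most one** (the `lip` form of `lev_adj`, for
skeletons with diagonal edges). [folklore] -/
theorem lev_le_lev_add_one_of_abs_sub_le_one {δ : MDir} (v : Site 2) {t t' : Site 2} (h : |t' δ.1 - t δ.1| ≤ 1) :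
    C.lev δ v t' ≤ C.lev δ v t + 1 := by
  unfold lev
  rw [abs_le] at h
  rcases sgOf_sign δ with hs | hs <;> rw [hs] <;> omega

/-! ## Cells and zones against cubes (wide boxes; gaps `5r`, `≥ 10s`) -/

/-- **Cells of other macro-vertices are ℓ^∞-gap separated from the cube `Q_v`** (`u ≠ v`; gap `5r`). [cite: KozmaNitzan2024, §4 p. 26] -/
theorem Cell_sepInf_Q {u v : Site 2} (huv : u ≠ v) : SepInf (↑(C.Cell u) : Set (Site 2)) ↑(C.Q v) := by
  intro y hy z hz
  rw [Finset.mem_coe, Cell, C.mem_sq_iff] at hy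
  rw [Finset.mem_coe, Q, C.mem_sq_iff] at hz
  have hr : (1 : ℤ) ≤ C.r := by exact_mod_cast C.one_le_r
  have hne : ∃ i : Fin 2, u i ≠ v i := by
    by_contra h
    push Not at h
    exact huv (funext h)
  obtain ⟨i, hi⟩ := hne
  have hyi := hy i; have hzi := hz i
  push_cast at hyi hzi
  rcases C.cen_cases u v i with ⟨hk, hc⟩ | ⟨hk, hc⟩ | ⟨hk, hc⟩ | ⟨hk, hc⟩ | ⟨hk, hc⟩
  · exact sepInf_of_gap i (by omega)
  · exact sepInf_of_gap i (by omega)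
  · exact absurd hk hi
  · exact sepInf_of_gap i (by omega)
  · exact sepInf_of_gap i (by omega)

/-- **Stub zones are ℓ^∞-gap separated from every cube** `Q_v` (gap `≥ min (5r, 10s)`). [cite: KozmaNitzan2024, §4 p. 26] -/
theorem Zone_sepInf_Q (u : Site 2) (δ : MDir) (v : Site 2) : SepInf (↑(C.Zone u δ) : Set (Site 2)) ↑(C.Q v) := by
  intro y hy z hz
  rw [Finset.mem_coe, Zone, mem_psBox_iff] at hy
  rw [Finset.mem_coe, Q, C.mem_sq_iff] at hz
  obtain ⟨⟨hy1, hy2⟩, -, -⟩ := hy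
  have hr : (1 : ℤ) ≤ C.r := by exact_mod_cast C.one_le_r
  have hs1 : (1 : ℤ) ≤ C.s := by exact_mod_cast C.hs
  have hs20 : 20 * (C.s : ℤ) ≤ C.r := by exact_mod_cast C.twenty_mul_s_le_r
  have hza := hz δ.1
  push_cast at hza
  rcases C.cen_cases u v δ.1 with ⟨hk, hc⟩ | ⟨hk, hc⟩ | ⟨hk, hc⟩ | ⟨hk, hc⟩ | ⟨hk, hc⟩ <;>
    rcases sgOf_sign δ with hs | hs <;> rw [hs] at hy1 hy2 <;> exact sepInf_of_gap δ.1 (by omega)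

/-! ## The far region against cells, zones and sibling between-boxes -/

/-- **Cells of other macro-vertices are ℓ^∞-gap separated from `E^far_{v,δ}`** (`u ≠ v`, `u ≠ v + δ`; gap `5r`; wide boxes).
[cite: KozmaNitzan2024, §4 p. 31] -/
theorem Cell_sepInf_Efar {u v : Site 2} {δ : MDir} (huv : u ≠ v) (hux : u ≠ v + stepVec δ) :
    SepInf (↑(C.Cell u) : Set (Site 2)) ↑(C.Efar v δ) := by
  intro y hy z hz
  rw [Finset.mem_coe, Cell, C.mem_sq_iff] at hy
  rw [Finset.mem_coe, Efar, mem_psBox_iff] at hz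
  obtain ⟨⟨hz1, hz2⟩, hz3, hz4⟩ := hz
  have hya := hy δ.1; have hyb := hy (oth δ.1)
  push_cast at hya hyb
  have hr : (1 : ℤ) ≤ C.r := by exact_mod_cast C.one_le_r
  have hxa : (v + stepVec δ) δ.1 = v δ.1 + sgOf δ := by rw [Pi.add_apply, stepVec_apply_fst]
  have hxb : (v + stepVec δ) (oth δ.1) = v (oth δ.1) := by rw [Pi.add_apply, stepVec_apply_oth, add_zero]
  rcases C.cen_cases u v (oth δ.1) with ⟨hk, hc⟩ | ⟨hk, hc⟩ | ⟨hk, hc⟩ | ⟨hk, hc⟩ | ⟨hk, hc⟩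
  · exact sepInf_of_gap (oth δ.1) (by omega)
  · exact sepInf_of_gap (oth δ.1) (by omega)
  · -- same row: compare along the axis, `u_a ∉ {v_a, v_a + σ}`
    have hne1 : u δ.1 ≠ v δ.1 := fun h => huv (eq_of_coords δ.1 h hk)
    have hne2 : u δ.1 ≠ v δ.1 + sgOf δ := fun h => hux (eq_of_coords δ.1 (by rw [hxa, h]) (by rw [hxb, hk]))
    rcases C.cen_cases u v δ.1 with ⟨hk', hc'⟩ | ⟨hk', hc'⟩ | ⟨hk', hc'⟩ | ⟨hk', hc'⟩ | ⟨hk', hc'⟩ <;>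
      rcases sgOf_sign δ with hs | hs <;> rw [hs] at hz1 hz2 hne2 <;>
      first | exact absurd hk' hne1 | exact sepInf_of_gap δ.1 (by omega)
  · exact sepInf_of_gap (oth δ.1) (by omega)
  · exact sepInf_of_gap (oth δ.1) (by omega)

/-- **Stub zones of other macro-vertices are ℓ^∞-gap separated from `E^far_{v,δ}`** (`u ≠ v`, `u ≠ v + δ`; gap `10s`; wide boxes).
[cite: KozmaNitzan2024, §4 p. 31] -/
theorem Zone_sepInf_Efar {u v : Site 2} {δ : MDir} (huv : u ≠ v) (hux : u ≠ v + stepVec δ) (δ' : MDir) :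
    SepInf (↑(C.Zone u δ') : Set (Site 2)) ↑(C.Efar v δ) := by
  intro y hy z hz
  rw [Finset.mem_coe, Zone, mem_psBox_iff] at hy
  rw [Finset.mem_coe, Efar, mem_psBox_iff] at hz
  obtain ⟨⟨hy1, hy2⟩, hy3, hy4⟩ := hy
  obtain ⟨⟨hz1, hz2⟩, hz3, hz4⟩ := hz
  have hr : (1 : ℤ) ≤ C.r := by exact_mod_cast C.one_le_r
  have hs1 : (1 : ℤ) ≤ C.s := by exact_mod_cast C.hs
  have hs20 : 20 * (C.s : ℤ) ≤ C.r := by exact_mod_cast C.twenty_mul_s_le_r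
  have hxa : (v + stepVec δ) δ.1 = v δ.1 + sgOf δ := by rw [Pi.add_apply, stepVec_apply_fst]
  have hxb : (v + stepVec δ) (oth δ.1) = v (oth δ.1) := by rw [Pi.add_apply, stepVec_apply_oth, add_zero]
  by_cases hax : δ'.1 = δ.1
  · -- zone axis = far axis
    rw [hax] at hy1 hy2 hy3 hy4
    rcases C.cen_cases u v (oth δ.1) with ⟨hk, hc⟩ | ⟨hk, hc⟩ | ⟨hk, hc⟩ | ⟨hk, hc⟩ | ⟨hk, hc⟩
    · exact sepInf_of_gap (oth δ.1) (by omega)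
    · exact sepInf_of_gap (oth δ.1) (by omega)
    · have hne1 : u δ.1 ≠ v δ.1 := fun h => huv (eq_of_coords δ.1 h hk)
      have hne2 : u δ.1 ≠ v δ.1 + sgOf δ := fun h => hux (eq_of_coords δ.1 (by rw [hxa, h]) (by rw [hxb, hk]))
      rcases C.cen_cases u v δ.1 with ⟨hk', hc'⟩ | ⟨hk', hc'⟩ | ⟨hk', hc'⟩ | ⟨hk', hc'⟩ | ⟨hk', hc'⟩ <;>
        rcases sgOf_sign δ with hs | hs <;> rw [hs] at hz1 hz2 hne2 <;>
        rcases sgOf_sign δ' with hs' | hs' <;> rw [hs'] at hy1 hy2 <;>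
        first | exact absurd hk' hne1 | exact sepInf_of_gap δ.1 (by omega)
    · exact sepInf_of_gap (oth δ.1) (by omega)
    · exact sepInf_of_gap (oth δ.1) (by omega)
  · -- zone axis `δ'.1 = oth δ.1`: the zone's transverse coordinate is the far axis
    have hoth : δ'.1 = oth δ.1 := eq_oth_of_ne hax
    have hoth2 : oth δ'.1 = δ.1 := by rw [hoth, oth_oth]
    rw [hoth2] at hy3 hy4
    rw [hoth] at hy1 hy2
    rcases C.cen_cases u v δ.1 with ⟨hk, hc⟩ | ⟨hk, hc⟩ | ⟨hk, hc⟩ | ⟨hk, hc⟩ | ⟨hk, hc⟩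
    · exact sepInf_of_gap δ.1 (by rcases sgOf_sign δ with hs | hs <;> rw [hs] at hz1 hz2 <;> omega)
    · rcases sgOf_sign δ with hs | hs <;> rw [hs] at hz1 hz2
      · exact sepInf_of_gap δ.1 (by omega)
      · -- `u_a = v_a - 1 = x_a` (σ = -1): compare the transverse coordinate
        rcases C.cen_cases u v (oth δ.1) with ⟨hm, hd⟩ | ⟨hm, hd⟩ | ⟨hm, hd⟩ | ⟨hm, hd⟩ | ⟨hm, hd⟩ <;>
          rcases sgOf_sign δ' with hs' | hs' <;> rw [hs'] at hy1 hy2 <;>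
          exact sepInf_of_gap (oth δ.1) (by omega)
    · exact sepInf_of_gap δ.1 (by rcases sgOf_sign δ with hs | hs <;> rw [hs] at hz1 hz2 <;> omega)
    · rcases sgOf_sign δ with hs | hs <;> rw [hs] at hz1 hz2
      · -- `u_a = v_a + 1 = x_a` (σ = 1): compare the transverse coordinate
        rcases C.cen_cases u v (oth δ.1) with ⟨hm, hd⟩ | ⟨hm, hd⟩ | ⟨hm, hd⟩ | ⟨hm, hd⟩ | ⟨hm, hd⟩ <;>
          rcases sgOf_sign δ' with hs' | hs' <;> rw [hs'] at hy1 hy2 <;>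
          exact sepInf_of_gap (oth δ.1) (by omega)
      · exact sepInf_of_gap δ.1 (by omega)
    · exact sepInf_of_gap δ.1 (by rcases sgOf_sign δ with hs | hs <;> rw [hs] at hz1 hz2 <;> omega)

/-- **The NARROW sibling between-box `BtwN v δ'` is ℓ^∞-gap separated from `E^far_{v,δ}`** (`δ' ≠ δ`): along the axis for the reversed
direction (gap `10r + 2`), across it with gap `(5r + 1) − (5r − 1) = 2` — THE pair for which the wide boxes are tight (ruling (A2)).
[cite: KozmaNitzan2024, §4 p. 31 ((31))] -/
theorem BtwN_sepInf_Efar (v : Site 2) {δ δ' : MDir} (h : δ' ≠ δ) : SepInf (↑(C.BtwN v δ') : Set (Site 2)) ↑(C.Efar v δ) := by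
  intro y hy z hz
  rw [Finset.mem_coe, BtwN, mem_psBox_iff] at hy
  rw [Finset.mem_coe, Efar, mem_psBox_iff] at hz
  obtain ⟨⟨hy1, hy2⟩, hy3, hy4⟩ := hy
  obtain ⟨⟨hz1, hz2⟩, hz3, hz4⟩ := hz
  have hr : (1 : ℤ) ≤ C.r := by exact_mod_cast C.one_le_r
  by_cases hax : δ'.1 = δ.1
  · -- same axis, opposite signs: levels on opposite sides of `Q_v`
    have hsg : sgOf δ' = -sgOf δ := by
      have hne : δ'.2 ≠ δ.2 := fun h2 => h (Prod.ext hax h2)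
      unfold sgOf; rcases Bool.eq_false_or_eq_true δ.2 with hb | hb <;> simp_all
    rw [hax, hsg] at hy1 hy2
    refine sepInf_of_gap δ.1 ?_
    rcases sgOf_sign δ with hs | hs <;> rw [hs] at hy1 hy2 hz1 hz2 <;> omega
  · -- different axes: the transverse coordinate of `BtwN v δ'` is the axis of `Efar v δ`
    have hoth : δ.1 = oth δ'.1 := eq_oth_of_ne (Ne.symm hax)
    rw [← hoth] at hy3 hy4
    refine sepInf_of_gap δ.1 ?_
    rcases sgOf_sign δ with hs | hs <;> rw [hs] at hz1 <;> omega

/-- **A sibling between-box `Btw v δ'` is ℓ^∞-gap separated from the target cube `Q_{v+δ}`** (`δ' ≠ δ`; gaps `10r` across, `20r` along;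
wide boxes). [cite: KozmaNitzan2024, §4 p. 26 ((29))] -/
theorem Btw_sepInf_Q_add (v : Site 2) {δ δ' : MDir} (h : δ' ≠ δ) : SepInf (↑(C.Btw v δ') : Set (Site 2)) ↑(C.Q (v + stepVec δ)) := by
  intro y hy z hz
  rw [Finset.mem_coe, Btw, mem_psBox_iff] at hy
  rw [Finset.mem_coe, Q, C.mem_sq_iff] at hz
  obtain ⟨⟨hy1, hy2⟩, hy3, hy4⟩ := hy
  have hza := hz δ.1
  rw [C.cen_add_stepVec_fst] at hza
  push_cast at hza
  have hr : (1 : ℤ) ≤ C.r := by exact_mod_cast C.one_le_r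
  by_cases hax : δ'.1 = δ.1
  · have hsg : sgOf δ' = -sgOf δ := by
      have hne : δ'.2 ≠ δ.2 := fun h2 => h (Prod.ext hax h2)
      unfold sgOf; rcases Bool.eq_false_or_eq_true δ.2 with hb | hb <;> simp_all
    rw [hax, hsg] at hy1 hy2
    refine sepInf_of_gap δ.1 ?_
    rcases sgOf_sign δ with hs | hs <;> rw [hs] at hy1 hy2 hza <;> omega
  · have hoth : δ.1 = oth δ'.1 := eq_oth_of_ne (Ne.symm hax)
    rw [← hoth] at hy3 hy4
    refine sepInf_of_gap δ.1 ?_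
    rcases sgOf_sign δ with hs | hs <;> rw [hs] at hza <;> omega

/-! ### The narrow far region -/

/-- Cells of other macro-vertices are ℓ^∞-gap separated from `EfarN_{v,δ}`. [cite: KozmaNitzan2024, §4 p. 31] -/
theorem Cell_sepInf_EfarN {u v : Site 2} {δ : MDir} (huv : u ≠ v) (hux : u ≠ v + stepVec δ) :
    SepInf (↑(C.Cell u) : Set (Site 2)) ↑(C.EfarN v δ) :=
  (C.Cell_sepInf_Efar huv hux).mono le_rfl (Finset.coe_subset.2 (C.EfarN_subset_Efar v δ))

/-- Stub zones of other macro-vertices are ℓ^∞-gap separated from `EfarN_{v,δ}`. [cite: KozmaNitzan2024, §4 p. 31] -/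
theorem Zone_sepInf_EfarN {u v : Site 2} {δ : MDir} (huv : u ≠ v) (hux : u ≠ v + stepVec δ) (δ' : MDir) :
    SepInf (↑(C.Zone u δ') : Set (Site 2)) ↑(C.EfarN v δ) :=
  (C.Zone_sepInf_Efar huv hux δ').mono le_rfl (Finset.coe_subset.2 (C.EfarN_subset_Efar v δ))

/-- **Narrow sibling between-boxes are ℓ^∞-gap separated from the narrow far region** (`δ' ≠ δ`). [cite: KozmaNitzan2024, §4 p. 31 ((31))] -/
theorem BtwN_sepInf_EfarN (v : Site 2) {δ δ' : MDir} (h : δ' ≠ δ) : SepInf (↑(C.BtwN v δ') : Set (Site 2)) ↑(C.EfarN v δ) :=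
  (C.BtwN_sepInf_Efar v h).mono le_rfl (Finset.coe_subset.2 (C.EfarN_subset_Efar v δ))

/-- Narrow sibling between-boxes are ℓ^∞-gap separated from the target cube `Q_{v+δ}` (`δ' ≠ δ`). [cite: KozmaNitzan2024, §4 p. 26 ((29))] -/
theorem BtwN_sepInf_Q_add (v : Site 2) {δ δ' : MDir} (h : δ' ≠ δ) : SepInf (↑(C.BtwN v δ') : Set (Site 2)) ↑(C.Q (v + stepVec δ)) :=
  (C.Btw_sepInf_Q_add v h).mono (Finset.coe_subset.2 (C.BtwN_subset_Btw v δ')) le_rfl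

/-- `ℤ²` form: cells of other macro-vertices are separated from `EfarN_{v,δ}`. [cite: KozmaNitzan2024, §4 p. 31] -/
theorem Cell_sep_EfarN {u v : Site 2} {δ : MDir} (huv : u ≠ v) (hux : u ≠ v + stepVec δ) :
    KozmaNitzan.Sep (↑(C.Cell u) : Set (Site 2)) ↑(C.EfarN v δ) :=
  sepZ2_of_sepInf (C.Cell_sepInf_EfarN huv hux)

/-- `ℤ²` form: stub zones of other macro-vertices are separated from `EfarN_{v,δ}`. [cite: KozmaNitzan2024, §4 p. 31] -/
theorem Zone_sep_EfarN {u v : Site 2} {δ : MDir} (huv : u ≠ v) (hux : u ≠ v + stepVec δ) (δ' : MDir) :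
    KozmaNitzan.Sep (↑(C.Zone u δ') : Set (Site 2)) ↑(C.EfarN v δ) :=
  sepZ2_of_sepInf (C.Zone_sepInf_EfarN huv hux δ')

/-- `ℤ²` form: narrow sibling between-boxes are separated from `EfarN_{v,δ}`. [cite: KozmaNitzan2024, §4 p. 31 ((31))] -/
theorem BtwN_sep_EfarN (v : Site 2) {δ δ' : MDir} (h : δ' ≠ δ) : KozmaNitzan.Sep (↑(C.BtwN v δ') : Set (Site 2)) ↑(C.EfarN v δ) :=
  sepZ2_of_sepInf (C.BtwN_sepInf_EfarN v h)

/-! ## The narrow probe world `BtwN v δ ∪ Q x ∪ Hfull x du` and `hSQ / hSB / hSS` -/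

/-- **The narrow planar world of the probe `v → v+δ → v+δ+du`**: the narrow between-box, the target cube and its corridor.
[cite: KozmaNitzan2024, §4 p. 26 (E_{v,x}, H_{x,y})] -/
def probeWorldN (v : Site 2) (δ du : MDir) : Finset (Site 2) := C.BtwN v δ ∪ C.Q (v + stepVec δ) ∪ C.Hfull (v + stepVec δ) du

/-- The narrow probe world lies in `EfarN v δ ∪ Q x ∪ EfarN x du` (`x = v + δ`). [folklore] -/
theorem probeWorldN_subset (v : Site 2) (δ du : MDir) :
    (↑(C.probeWorldN v δ du) : Set (Site 2)) ⊆ ↑(C.EfarN v δ) ∪ (↑(C.Q (v + stepVec δ)) ∪ ↑(C.EfarN (v + stepVec δ) du)) := by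
  intro t ht
  rw [Finset.mem_coe, probeWorldN] at ht
  rcases Finset.mem_union.1 ht with ht | ht
  · rcases Finset.mem_union.1 ht with ht | ht
    · exact Or.inl (Finset.mem_coe.2 (C.BtwN_subset_EfarN v δ ht))
    · exact Or.inr (Or.inl (Finset.mem_coe.2 ht))
  · rcases Finset.mem_union.1 (C.Hfull_subset_Q_union_EfarN _ du ht) with h' | h'
    · exact Or.inr (Or.inl (Finset.mem_coe.2 h'))
    · exact Or.inr (Or.inr (Finset.mem_coe.2 h'))

/-- **A cell off the lineage is ℓ^∞-gap separated from the narrow probe world** (`u ∉ {v, x, y}`). [cite: KozmaNitzan2024, §4 p. 31] -/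
theorem Cell_sepInf_probeWorldN {v u : Site 2} {δ du : MDir} (huv : u ≠ v) (hux : u ≠ v + stepVec δ)
    (huy : u ≠ v + stepVec δ + stepVec du) : SepInf (↑(C.Cell u) : Set (Site 2)) ↑(C.probeWorldN v δ du) :=
  (sepInf_union_right (C.Cell_sepInf_EfarN huv hux)
    (sepInf_union_right (C.Cell_sepInf_Q hux) (C.Cell_sepInf_EfarN hux huy))).mono le_rfl (C.probeWorldN_subset v δ du)

/-- **A stub zone off the lineage is ℓ^∞-gap separated from the narrow probe world** (`u ∉ {v, x, y}`). [cite: KozmaNitzan2024, §4 p. 31] -/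
theorem Zone_sepInf_probeWorldN {v u : Site 2} {δ du : MDir} (huv : u ≠ v) (hux : u ≠ v + stepVec δ)
    (huy : u ≠ v + stepVec δ + stepVec du) (δ' : MDir) : SepInf (↑(C.Zone u δ') : Set (Site 2)) ↑(C.probeWorldN v δ du) :=
  (sepInf_union_right (C.Zone_sepInf_EfarN huv hux δ')
    (sepInf_union_right (C.Zone_sepInf_Q u δ' _) (C.Zone_sepInf_EfarN hux huy δ'))).mono le_rfl (C.probeWorldN_subset v δ du)

/-- **`hSQ` (gap-2 form): cubes off the lineage are ℓ^∞-gap separated from the narrow probe world.** [cite: KozmaNitzan2024, §4 p. 26 ((29))] -/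
theorem Q_sepInf_probeWorldN (v : Site 2) (δ du : MDir) (u : Site 2) (_hvy : v + stepVec δ + stepVec du ≠ v) (huv : u ≠ v)
    (hux : u ≠ v + stepVec δ) (huy : u ≠ v + stepVec δ + stepVec du) :
    SepInf (↑(C.Q u) : Set (Site 2)) ↑(C.probeWorldN v δ du) :=
  (C.Cell_sepInf_probeWorldN huv hux huy).mono (Finset.coe_subset.2 (C.Q_subset_Cell u)) le_rfl

/-- **`hSB` (gap-2 form): narrow between-boxes off the lineage are ℓ^∞-gap separated from the narrow probe world** (`w ∉ {x, y}`,
`w + δ' ∉ {v, x, y}`; the sibling boxes of `v` itself included — the case repaired by the narrowing). [cite: KozmaNitzan2024, §4 p. 31 ((31))] -/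
theorem BtwN_sepInf_probeWorldN (v : Site 2) (δ du : MDir) (w : Site 2) (δ' : MDir) (_hvy : v + stepVec δ + stepVec du ≠ v)
    (hwx : w ≠ v + stepVec δ) (hwy : w ≠ v + stepVec δ + stepVec du) (hw'v : w + stepVec δ' ≠ v) (hw'x : w + stepVec δ' ≠ v + stepVec δ)
    (hw'y : w + stepVec δ' ≠ v + stepVec δ + stepVec du) :
    SepInf (↑(C.BtwN w δ') : Set (Site 2)) ↑(C.probeWorldN v δ du) := by
  by_cases hwv : w = v
  · subst hwv
    have hδ : δ' ≠ δ := fun h => hw'x (by rw [h])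
    -- the sibling box: gap-2 against `EfarN w δ ⊇ BtwN w δ`, against `Q x` directly, and (inside `Cell w ∪ Cell (w + δ')`) against `EfarN x du`
    refine PlanarSkeleton.SepInf.mono ?_ le_rfl (C.probeWorldN_subset w δ du)
    refine sepInf_union_right (C.BtwN_sepInf_EfarN w hδ) (sepInf_union_right (C.BtwN_sepInf_Q_add w hδ) ?_)
    refine PlanarSkeleton.SepInf.mono ?_ (Finset.coe_subset.2 (C.BtwN_subset_Cells w δ')) le_rfl
    rw [Finset.coe_union]
    refine sepInf_union_left (C.Cell_sepInf_EfarN (Ne.symm ?_) (Ne.symm ?_)) (C.Cell_sepInf_EfarN hw'x hw'y)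
    · intro h; exact hwx h.symm
    · intro h; exact hwy h.symm
  · refine PlanarSkeleton.SepInf.mono ?_ (Finset.coe_subset.2 (C.BtwN_subset_Cells w δ')) le_rfl
    rw [Finset.coe_union]
    exact sepInf_union_left (C.Cell_sepInf_probeWorldN hwv hwx hwy) (C.Cell_sepInf_probeWorldN hw'v hw'x hw'y)

/-- **`hSS` (gap-2 form): stubs off the lineage are ℓ^∞-gap separated from the narrow probe world** (`u ∉ {v, x, y}`, `j + 1 ≤ K`).
[cite: KozmaNitzan2024, §4 p. 31] -/
theorem Stub_sepInf_probeWorldN (v : Site 2) (δ du : MDir) (u : Site 2) (du' : MDir) (j : ℕ) (_hvy : v + stepVec δ + stepVec du ≠ v)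
    (huv : u ≠ v) (hux : u ≠ v + stepVec δ) (huy : u ≠ v + stepVec δ + stepVec du) (hj : j + 1 ≤ C.K) :
    SepInf (↑(C.Stub u du' j) : Set (Site 2)) ↑(C.probeWorldN v δ du) := by
  refine PlanarSkeleton.SepInf.mono ?_ (Finset.coe_subset.2 (C.Stub_subset_Cell_union_Zone u du' (by omega))) le_rfl
  rw [Finset.coe_union]
  exact sepInf_union_left (C.Cell_sepInf_probeWorldN huv hux huy) (C.Zone_sepInf_probeWorldN huv hux huy du')

/-- **`hSQ`, `ℤ²` form.** [cite: KozmaNitzan2024, §4 p. 26 ((29))] -/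
theorem Q_sep_probeWorldN (v : Site 2) (δ du : MDir) (u : Site 2) (hvy : v + stepVec δ + stepVec du ≠ v) (huv : u ≠ v)
    (hux : u ≠ v + stepVec δ) (huy : u ≠ v + stepVec δ + stepVec du) :
    KozmaNitzan.Sep (↑(C.Q u) : Set (Site 2)) ↑(C.probeWorldN v δ du) :=
  sepZ2_of_sepInf (C.Q_sepInf_probeWorldN v δ du u hvy huv hux huy)

/-- **`hSB`, `ℤ²` form.** [cite: KozmaNitzan2024, §4 p. 31 ((31))] -/
theorem BtwN_sep_probeWorldN (v : Site 2) (δ du : MDir) (w : Site 2) (δ' : MDir) (hvy : v + stepVec δ + stepVec du ≠ v)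
    (hwx : w ≠ v + stepVec δ) (hwy : w ≠ v + stepVec δ + stepVec du) (hw'v : w + stepVec δ' ≠ v) (hw'x : w + stepVec δ' ≠ v + stepVec δ)
    (hw'y : w + stepVec δ' ≠ v + stepVec δ + stepVec du) :
    KozmaNitzan.Sep (↑(C.BtwN w δ') : Set (Site 2)) ↑(C.probeWorldN v δ du) :=
  sepZ2_of_sepInf (C.BtwN_sepInf_probeWorldN v δ du w δ' hvy hwx hwy hw'v hw'x hw'y)

/-- **`hSS`, `ℤ²` form.** [cite: KozmaNitzan2024, §4 p. 31] -/
theorem Stub_sep_probeWorldN (v : Site 2) (δ du : MDir) (u : Site 2) (du' : MDir) (j : ℕ) (hvy : v + stepVec δ + stepVec du ≠ v)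
    (huv : u ≠ v) (hux : u ≠ v + stepVec δ) (huy : u ≠ v + stepVec δ + stepVec du) (hj : j + 1 ≤ C.K) :
    KozmaNitzan.Sep (↑(C.Stub u du' j) : Set (Site 2)) ↑(C.probeWorldN v δ du) :=
  sepZ2_of_sepInf (C.Stub_sepInf_probeWorldN v δ du u du' j hvy huv hux huy hj)

end PCells

end Transplant

end Summit.CriticalPhenomena.PercolationContinuityZ3.Theorems

end
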